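import Mathlib.RingTheory.NoetherNormalization
import Mathlib.RingTheory.Ideal.GoingUp
import Mathlib.Algebra.Polynomial.Roots
import Mathlib.Analysis.Complex.Cardinality
import HarnessLib

/-!
# Route PeriodDeficiency — `QbarGenericIsHodgeGeneric` (stmt-HodgeConjecture-11595), line `registered`, reshape r5 (lead c2): stub (iv'-b1) `stub_exists_maximal_avoiding_countable`

This file proves, UNCONDITIONALLY and from Mathlib alone, the registered stub (iv'-b1) of the line
skeleton `Cruxes/QbarGenericIsHodgeGeneric/Lines/birth.lean` (reshape r5 of lead c2): **countable
prime avoidance above a prime in a finitely generated `ℂ`-algebra**, the purely algebraic heart of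
the classical fact "an irreducible complex algebraic variety is not a countable union of proper
closed subvarieties" (which the neighbouring stubs (iv'-b2), (iv'-c) turn into the countability of
the special subvarieties of a family meeting an affine chart).

**Statement (`stub_exists_maximal_avoiding_countable`).** Let `A` be a commutative `ℂ`-algebra of
finite type, `𝔭 ⊂ A` a prime ideal and `I 0, I 1, … ⊆ A` countably many ideals, none of them
contained in `𝔭`. Then there is a maximal ideal `𝔪 ⊇ 𝔭` of `A` containing none of the `I k`.

**Proof.**
1. Pass to the finitely generated domain `B = A ⧸ 𝔭`; since `I k ⊄ 𝔭`, some `a k ∈ I k` has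
   nonzero image `ā k ∈ B`.
2. Noether normalisation (Mathlib `exists_integral_inj_algHom_of_fg`): an injective `ℂ`-algebra map
   `g : ℂ[y_0,…,y_{s-1}] → B` with `B` integral over the polynomial ring `P`.
3. A nonzero element of a domain which is integral over `P` has a nonzero multiple in `P`
   (Mathlib `Ideal.comap_ne_bot_of_integral_mem`): there are nonzero polynomials `b k ∈ P` with
   `g (b k) ∈ (ā k)`.
4. `ℂ^s` is not a countable union of hypersurfaces (`exists_forall_eval_ne_zero`): there is a point
   `c ∈ ℂ^s` with `(b k)(c) ≠ 0` for every `k`. Induction on `s` via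
   `MvPolynomial.finSuccEquiv`: choose the last `s` coordinates off the zero sets of the (nonzero)
   leading coefficients, then the first coordinate off the countable union of the finite root sets
   of the resulting nonzero one-variable polynomials — possible because `ℂ` is uncountable
   (Mathlib `not_countable_complex`).
5. Lying over (Mathlib `Ideal.exists_ideal_over_maximal_of_isIntegral`): a maximal ideal `Q` of
   `B` contracts to the maximal ideal `ker (eval c)` of `P`. If `(I k)·B ⊆ Q` then `g (b k) ∈ Q`,
   so `(b k)(c) = 0` — excluded. Finally `𝔪 = Q.comap (A → A ⧸ 𝔭)` is maximal
   (`Ideal.comap_isMaximal_of_surjective`), contains `𝔭`, and contains no `I k`.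

Everything used is in Mathlib; no named fact is assumed. Nothing Hodge-theoretic is in this file.

## References

* Folklore; e.g. R. Hartshorne, Algebraic Geometry, Ex. V.4.15(c) remark, or the standard Baire /
  counting argument over an uncountable field. Noether normalisation: Stacks Project, Tag 00OW.
-/

noncomputable section

-- every declaration of this problem lives in `Summit.HodgeConjecture.HodgeConjecture.…` (summit = sub-problem)
set_option linter.dupNamespace false

namespace Summit.HodgeConjecture.HodgeConjecture.Theorems

/-- **`ℂ^s` is not a countable union of hypersurfaces.** For countably many nonzero polynomials
`p k ∈ ℂ[y_0,…,y_{s-1}]` there is a point `c ∈ ℂ^s` at which none of them vanishes. Induction on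
`s` (`MvPolynomial.finSuccEquiv`, finiteness of the roots of a nonzero one-variable polynomial,
uncountability of `ℂ`). [folklore] -/
theorem exists_forall_eval_ne_zero :
    ∀ (s : ℕ) (p : ℕ → MvPolynomial (Fin s) ℂ), (∀ k, p k ≠ 0) →
      ∃ c : Fin s → ℂ, ∀ k, MvPolynomial.eval c (p k) ≠ 0
  | 0, p, hp => by
    refine ⟨Fin.elim0, fun k h => hp k ?_⟩
    obtain ⟨x, hx⟩ := MvPolynomial.C_surjective (Fin 0) (p k)
    rw [← hx, MvPolynomial.eval_C] at h
    rw [← hx, h, MvPolynomial.C_0]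
  | s + 1, p, hp => by
    -- view `p k` as a one-variable polynomial `q k` over `ℂ[y_1,…,y_s]`
    set q : ℕ → Polynomial (MvPolynomial (Fin s) ℂ) :=
      fun k => MvPolynomial.finSuccEquiv ℂ s (p k) with hq_def
    have hq : ∀ k, q k ≠ 0 := fun k => EmbeddingLike.map_ne_zero_iff.2 (hp k)
    -- the leading coefficients are nonzero: choose the last `s` coordinates off their zero sets
    obtain ⟨c', hc'⟩ := exists_forall_eval_ne_zero s (fun k => (q k).leadingCoeff)
      (fun k => Polynomial.leadingCoeff_ne_zero.mpr (hq k))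
    have hq' : ∀ k, Polynomial.map (MvPolynomial.eval c') (q k) ≠ 0 := fun k h => hc' k (by
      rw [← Polynomial.leadingCoeff_map_of_leadingCoeff_ne_zero _ (hc' k), h,
        Polynomial.leadingCoeff_zero])
    -- the bad first coordinates form a countable set, which is not all of `ℂ`
    have hcount : (⋃ k, {t : ℂ | (Polynomial.map (MvPolynomial.eval c') (q k)).IsRoot t}).Countable :=
      Set.countable_iUnion fun k => (Polynomial.finite_setOf_isRoot (hq' k)).countable
    obtain ⟨t, ht⟩ :
        ∃ t : ℂ, t ∉ ⋃ k, {t : ℂ | (Polynomial.map (MvPolynomial.eval c') (q k)).IsRoot t} := by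
      by_contra h
      push Not at h
      exact not_countable_complex (hcount.mono fun t _ => h t)
    refine ⟨Fin.cons t c', fun k hk => ht (Set.mem_iUnion.mpr ⟨k, ?_⟩)⟩
    rw [MvPolynomial.eval_eq_eval_mv_eval'] at hk
    exact hk

/-- STUB (iv'-b1) — **countable prime avoidance in a finitely generated `ℂ`-algebra** (the algebraic
heart of "a complex variety is not a countable union of proper closed subvarieties"): for `A` of
finite type over `ℂ`, a prime `𝔭` and countably many ideals `I k ⊄ 𝔭`, some maximal ideal contains
`𝔭` and none of the `I k`. Proof: pass to the domain `A ⧸ 𝔭`; Noether normalisation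
`ℂ[y_0,…,y_{s-1}] ↪ A ⧸ 𝔭` integral (Mathlib `exists_integral_inj_algHom_of_fg`); each nonzero
image ideal contains the image of a nonzero polynomial (`Ideal.comap_ne_bot_of_integral_mem`);
`ℂ^s` is not covered by countably many hypersurfaces (`exists_forall_eval_ne_zero`); lying over
(`Ideal.exists_ideal_over_maximal_of_isIntegral`) and pull-back along `A → A ⧸ 𝔭`. [folklore] -/
theorem stub_exists_maximal_avoiding_countable :
    ∀ (A : Type) [CommRing A] [Algebra ℂ A] [Algebra.FiniteType ℂ A] (𝔭 : Ideal A) [𝔭.IsPrime]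
      (I : ℕ → Ideal A), (∀ k, ¬ I k ≤ 𝔭) →
      ∃ 𝔪 : Ideal A, 𝔪.IsMaximal ∧ 𝔭 ≤ 𝔪 ∧ ∀ k, ¬ I k ≤ 𝔪 := by
  intro A _ _ _ 𝔭 _ I hI
  -- Step 1: nonzero witnesses in the domain `A ⧸ 𝔭`
  have ha : ∀ k, ∃ a : A, a ∈ I k ∧ Ideal.Quotient.mk 𝔭 a ≠ 0 := by
    intro k
    by_contra h
    push Not at h
    exact hI k fun x hx => Ideal.Quotient.eq_zero_iff_mem.mp (h x hx)
  choose a haI ha0 using ha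
  -- Step 2: Noether normalisation of `A ⧸ 𝔭`
  obtain ⟨s, g, hg_inj, hg_int⟩ := exists_integral_inj_algHom_of_fg ℂ (A ⧸ 𝔭)
  letI : Algebra (MvPolynomial (Fin s) ℂ) (A ⧸ 𝔭) := g.toRingHom.toAlgebra
  haveI : Algebra.IsIntegral (MvPolynomial (Fin s) ℂ) (A ⧸ 𝔭) := ⟨fun x => hg_int x⟩
  -- Step 3: nonzero polynomials `b k` with `g (b k) ∈ (ā k)`
  have hb : ∀ k, ∃ b : MvPolynomial (Fin s) ℂ, b ≠ 0 ∧
      g b ∈ Ideal.span {Ideal.Quotient.mk 𝔭 (a k)} := by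
    intro k
    have hne : (Ideal.span {Ideal.Quotient.mk 𝔭 (a k)}).comap
        (algebraMap (MvPolynomial (Fin s) ℂ) (A ⧸ 𝔭)) ≠ ⊥ :=
      Ideal.comap_ne_bot_of_integral_mem (ha0 k) (Ideal.mem_span_singleton_self _)
        (Algebra.IsIntegral.isIntegral _)
    obtain ⟨b, hb, hb0⟩ := Submodule.exists_mem_ne_zero_of_ne_bot hne
    exact ⟨b, hb0, hb⟩
  choose b hb0 hbI using hb
  -- Step 4: a point of `ℂ^s` where no `b k` vanishes, and the maximal ideal of that point
  obtain ⟨c, hc⟩ := exists_forall_eval_ne_zero s b hb0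
  set 𝔫 : Ideal (MvPolynomial (Fin s) ℂ) := RingHom.ker (MvPolynomial.eval c) with h𝔫
  haveI : 𝔫.IsMaximal :=
    RingHom.ker_isMaximal_of_surjective _ fun x => ⟨MvPolynomial.C x, MvPolynomial.eval_C x⟩
  -- Step 5: lying over, then pull back to `A`
  have hker : RingHom.ker (algebraMap (MvPolynomial (Fin s) ℂ) (A ⧸ 𝔭)) ≤ 𝔫 := by
    intro x hx
    replace hx : g x = g 0 := by
      rw [map_zero]
      exact RingHom.mem_ker.mp hx
    rw [hg_inj hx]
    exact 𝔫.zero_mem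
  obtain ⟨Q, hQmax, hQ⟩ := Ideal.exists_ideal_over_maximal_of_isIntegral 𝔫 hker
  refine ⟨Q.comap (Ideal.Quotient.mk 𝔭),
    Ideal.comap_isMaximal_of_surjective _ Ideal.Quotient.mk_surjective, ?_, ?_⟩
  · intro x hx
    rw [Ideal.mem_comap, Ideal.Quotient.eq_zero_iff_mem.mpr hx]
    exact Q.zero_mem
  · intro k hk
    have h1 : Ideal.Quotient.mk 𝔭 (a k) ∈ Q := hk (haI k)
    have h2 : g (b k) ∈ Q := (Ideal.span_singleton_le_iff_mem Q).mpr h1 (hbI k)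
    have h3 : b k ∈ 𝔫 := by
      rw [← hQ, Ideal.mem_comap]
      exact h2
    exact hc k (RingHom.mem_ker.mp h3)

end Summit.HodgeConjecture.HodgeConjecture.Theorems
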